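import Summits.QuantumFields.QCD.Theorems.NestedDissectionSeaRobustYangMillsRGSchwarzFlattening

/-!
# Line `Sketch` for the crux `RobustYangMillsRG` (stmt-QuantumFields-14958) — stub
# `stub_secondOrderFlattening` (card `schwarz-flattening`, the (T2) flattening engine
# `typicalConeBound`'s core)

Crux: `Summit.QuantumFields.QCD.Theses.NestedDissectionSea.RobustYangMillsRG` (shared verbatim with
`HeavyThresholdYMBridge`), item stmt-QuantumFields-14958; skeleton `Cruxes/RobustYangMillsRG/Lines/Sketch.lean`
(lead `prover-line-stmt-QuantumFields-14958-0`).  The registered stub `stub_secondOrderFlattening`,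
closed: the SECOND-order companion of the landed lever `schwarz_flattening`.  If the activities of a
quasi-local gauge perturbation `W` are analytic with bounds `M X` on the g-uniform small-field domains
`smallFieldDomain ρ b r ε X`, then around every real `ε`-small configuration `U` each activity is affine
in the `ρ`-link variables up to a second-order error: with `ℓ` the Fréchet derivative at `c = ρ ∘ U` of
the holomorphic extension `F_X`,
`‖W_X(U') − W_X(U) − ℓ(ρ∘U' − ρ∘U)‖ ≤ 4 M_X δ² / r²` for `δ = dist(ρ∘U', ρ∘U) < r`.

Proof: the first-order Schwarz lemma bounds the derivative, `‖ℓ‖ ≤ 2 M_X / r`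
(Mathlib `Complex.norm_fderiv_le_div_of_mapsTo_ball`, the extension mapping the `r`-ball into the
closed `2 M_X`-ball around `F_X c`); hence the remainder `h w = F_X w − ℓ (w − c)` maps the `r`-ball
into the closed `4 M_X`-ball around `h c = F_X c`, and `h w − h c = o(‖w − c‖)` by the very definition
of the Fréchet derivative, so the second-order Schwarz lemma
(Mathlib `Complex.dist_le_mul_div_pow_of_mapsTo_ball_of_isLittleO` with `n = 1`) gives
`‖h c' − h c‖ ≤ 4 M_X (δ / r)²`, which is the claim.

Sources: Bałaban, CMP 119 (1988) p. 259 (ii), p. 261 (2.41)–(2.42) (analyticity domains and bounds);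
the Schwarz lemma.
-/

set_option autoImplicit false

noncomputable section

open MeasureTheory Filter Topology Metric Set
open scoped Matrix.Norms.Frobenius
open Literature.MathematicalPhysics.QuantumLattice Literature.MathematicalPhysics.QuantumFieldTheory

namespace Summit.QuantumFields.QCD.Cruxes.RobustYangMillsRG.Sketch

/-- **Second-order Schwarz lemma for a bounded holomorphic function on a ball** (generic engine):
if `F : E → ℂ` is holomorphic on `ball c r` with `‖F‖ ≤ M` there, then with `ℓ = fderiv ℂ F c`
one has `‖F z − F c − ℓ (z − c)‖ ≤ 4 M / r² · dist(z, c)²` for every `z ∈ ball c r`.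
(First-order Schwarz: `‖ℓ‖ ≤ 2M/r`; so `w ↦ F w − ℓ (w − c)` maps the ball into the closed `4M`-ball
around its value at `c` and is `o(‖w − c‖)` there, whence the second-order Schwarz lemma
`Complex.dist_le_mul_div_pow_of_mapsTo_ball_of_isLittleO`.) -/
theorem norm_sub_sub_fderiv_le_of_norm_le {E : Type*} [NormedAddCommGroup E] [NormedSpace ℂ E]
    {F : E → ℂ} {c z : E} {r M : ℝ} (hr : 0 < r)
    (hFd : DifferentiableOn ℂ F (ball c r)) (hFM : ∀ w ∈ ball c r, ‖F w‖ ≤ M)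
    (hz : z ∈ ball c r) :
    ‖F z - F c - fderiv ℂ F c (z - c)‖ ≤ 4 * M / r ^ 2 * dist z c ^ 2 := by
  have hcb : c ∈ ball c r := mem_ball_self hr
  -- first-order Schwarz: the derivative at the centre
  have hmapsF : MapsTo F (ball c r) (closedBall (F c) (2 * M)) := by
    intro w hw
    rw [mem_closedBall, dist_eq_norm]
    calc ‖F w - F c‖ ≤ ‖F w‖ + ‖F c‖ := norm_sub_le _ _
      _ ≤ M + M := add_le_add (hFM _ hw) (hFM _ hcb)
      _ = 2 * M := by ring
  set ℓ : E →L[ℂ] ℂ := fderiv ℂ F c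
  have hℓn : ‖ℓ‖ ≤ 2 * M / r := Complex.norm_fderiv_le_div_of_mapsTo_ball hFd hmapsF hr
  have hFat : HasFDerivAt F ℓ c := (hFd.differentiableAt (isOpen_ball.mem_nhds hcb)).hasFDerivAt
  have hM0 : 0 ≤ M := (norm_nonneg _).trans (hFM _ hcb)
  -- the second-order remainder
  set h : E → ℂ := fun w => F w - ℓ (w - c)
  have hhc : h c = F c := by simp [h]
  have hhd : DifferentiableOn ℂ h (ball c r) :=
    hFd.sub (ℓ.differentiable.comp (differentiable_id.sub_const c)).differentiableOn
  have hmaps : MapsTo h (ball c r) (closedBall (h c) (4 * M)) := by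
    intro w hw
    rw [mem_closedBall, hhc, dist_eq_norm]
    have h1 : ‖F w - F c‖ ≤ 2 * M := by
      have := hmapsF hw
      rwa [mem_closedBall, dist_eq_norm] at this
    have h2 : ‖ℓ (w - c)‖ ≤ 2 * M := by
      calc ‖ℓ (w - c)‖ ≤ ‖ℓ‖ * ‖w - c‖ := ℓ.le_opNorm _
        _ ≤ (2 * M / r) * r := by
          refine mul_le_mul hℓn ?_ (norm_nonneg _) (by positivity)
          rw [← dist_eq_norm]
          exact (mem_ball.1 hw).le
        _ = 2 * M := by field_simp
    calc ‖h w - F c‖ = ‖(F w - F c) - ℓ (w - c)‖ := by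
          simp only [h]; congr 1; ring
      _ ≤ ‖F w - F c‖ + ‖ℓ (w - c)‖ := norm_sub_le _ _
      _ ≤ 2 * M + 2 * M := add_le_add h1 h2
      _ = 4 * M := by ring
  have hn : (fun w => h w - h c) =o[𝓝 c] (fun w => ‖w - c‖ ^ 1) := by
    simp only [pow_one, Asymptotics.isLittleO_norm_right]
    refine hFat.isLittleO.congr_left fun w => ?_
    simp only [h, map_sub]
    ring
  have key := Complex.dist_le_mul_div_pow_of_mapsTo_ball_of_isLittleO hhd hmaps hn hz
  rw [dist_eq_norm, hhc] at key
  calc ‖F z - F c - ℓ (z - c)‖ = ‖h z - F c‖ := by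
        simp only [h]; congr 1; ring
    _ ≤ 4 * M * (dist z c / r) ^ (1 + 1) := key
    _ = 4 * M / r ^ 2 * dist z c ^ 2 := by ring

variable {d L N : ℕ} [NeZero L] {G : Type*} [Group G] [MeasurableSpace G] {b : ℕ}

/-- **Second-order Schwarz flattening.** If the activities of `W` are analytic on the g-uniform
small-field domains with bounds `M`, then around every real `ε`-small configuration `U` each activity
is affine in the link variables up to a second-order error: with `ℓ` the Fréchet derivative of the
holomorphic extension at `ρ ∘ U`, for every `U'` with `δ = dist (ρ ∘ U') (ρ ∘ U) < r`,
`‖W_X(U') − W_X(U) − ℓ (ρ∘U' − ρ∘U)‖ ≤ 4 M_X δ² / r²`. -/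
theorem second_order_flattening (ρ : G →* Matrix (Fin N) (Fin N) ℂ)
    (W : QuasiLocalGaugePerturbation d L G b)
    {r ε : ℝ} (hr : 0 < r) {M : Finset (Site d L) → ℝ}
    (hW : W.IsAnalyticOn ρ (smallFieldDomain ρ b r ε) M)
    {X : Finset (Site d L)} (hX : X ∈ polymers (d := d) (L := L) b) {U : GaugeConfig d L G}
    (hU : ∀ p ∈ polymerPlaquettes b X,
      (N : ℝ) - (ρ (plaquetteHolonomy U p.1 p.2.1.1 p.2.1.2)).trace.re ≤ ε) :
    ∃ ℓ : ComplexGaugeConfig d L N →L[ℂ] ℂ, ∀ (U' : GaugeConfig d L G),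
      dist (complexify ρ U') (complexify ρ U) < r →
        ‖((W.act X U' : ℝ) : ℂ) - (W.act X U : ℝ) - ℓ (complexify ρ U' - complexify ρ U)‖ ≤
          4 * M X / r ^ 2 * dist (complexify ρ U') (complexify ρ U) ^ 2 := by
  obtain ⟨F, hFd, hFW, hFM⟩ := hW X hX
  have hball : ball (complexify ρ U) r ⊆ smallFieldDomain ρ b r ε X :=
    ball_subset_smallFieldDomain ρ hU
  have hcD : complexify ρ U ∈ smallFieldDomain ρ b r ε X := hball (mem_ball_self hr)
  refine ⟨fderiv ℂ F (complexify ρ U), fun U' hδ => ?_⟩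
  have hc'b : complexify ρ U' ∈ ball (complexify ρ U) r := mem_ball.2 hδ
  -- the real activities are the restrictions of `F`
  have hWU : ((W.act X U : ℝ) : ℂ) = F (complexify ρ U) := (hFW U hcD).symm
  have hWU' : ((W.act X U' : ℝ) : ℂ) = F (complexify ρ U') := (hFW U' (hball hc'b)).symm
  rw [hWU, hWU']
  exact norm_sub_sub_fderiv_le_of_norm_le hr (hFd.mono hball) (fun w hw => hFM w (hball hw)) hc'b

/-! ### The registered stub `stub_secondOrderFlattening` (closed statement, verbatim from the skeleton) -/

/-- **Second-order Schwarz flattening** (`typicalConeBound`'s core, card `schwarz-flattening`): an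
activity analytic with bound `M X` on the g-uniform small-field domain is, around every real `ε`-small
configuration `U`, affine up to a SECOND-order error in the link distance: there is a complex-linear
functional `ℓ` (the derivative of the extension at `ρ ∘ U`) with
`‖W_X(U') − W_X(U) − ℓ(ρ∘U' − ρ∘U)‖ ≤ 4 M_X δ²/r²` for `δ = dist(ρ∘U', ρ∘U) < r` (one-variable Schwarz
lemma applied twice on the complex disc through the two configurations, via `dslope`). -/
def SecondOrderFlattening : Prop :=
  ∀ (d L N : ℕ) [NeZero L] (G : Type) [Group G] [MeasurableSpace G] (b : ℕ)
    (ρ : G →* Matrix (Fin N) (Fin N) ℂ) (W : QuasiLocalGaugePerturbation d L G b) (r ε : ℝ), 0 < r →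
    ∀ (M : Finset (Site d L) → ℝ), W.IsAnalyticOn ρ (smallFieldDomain ρ b r ε) M →
    ∀ X ∈ polymers (d := d) (L := L) b, ∀ (U : GaugeConfig d L G),
      (∀ p ∈ polymerPlaquettes b X,
        (N : ℝ) - (ρ (plaquetteHolonomy U p.1 p.2.1.1 p.2.1.2)).trace.re ≤ ε) →
      ∃ ℓ : ComplexGaugeConfig d L N →L[ℂ] ℂ, ∀ (U' : GaugeConfig d L G),
        dist (complexify ρ U') (complexify ρ U) < r →
          ‖((W.act X U' : ℝ) : ℂ) - (W.act X U : ℝ) - ℓ (complexify ρ U' - complexify ρ U)‖ ≤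
            4 * M X / r ^ 2 * dist (complexify ρ U') (complexify ρ U) ^ 2

/-- **stub_secondOrderFlattening** — the registered stub of line `Sketch`, closed by
`second_order_flattening`. -/
theorem stub_secondOrderFlattening : SecondOrderFlattening :=
  fun _d _L _N _ _G _ _ _b ρ W _r _ε hr _M hW _X hX _U hU =>
    second_order_flattening ρ W hr hW hX hU

end Summit.QuantumFields.QCD.Cruxes.RobustYangMillsRG.Sketch

end
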